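import Mathlib.MeasureTheory.Function.L2Space
import Mathlib.Analysis.SpecialFunctions.Pow.Real
import Mathlib.Analysis.SpecialFunctions.Integrability.Basic
import Literature.MathematicalPhysics.QuantumFieldTheory.Borinsky2020.ConeIntegral
import Literature.MathematicalPhysics.QuantumFieldTheory.Borinsky2020.TropicalSamplingEstimator
import HarnessLib

/-!
# Borinsky 2020 §7.3 «Expansions in regularization parameters»: the logarithmic insertions of the
# ε-expansion are SQUARE INTEGRABLE in the sector coordinates, so «Theorem 5 may still be applied» —
# PROVED (with Borinsky–Munch–Tellander 2023 §2.4 «the log^k factors cannot spoil the integrability»)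

Topic `MathematicalPhysics/QuantumFieldTheory`, companion of `Borinsky2020/ConeIntegral` (Lemma 17: the
sector coordinates `ξ ∈ (0,1)^{n−1}` of a simplicial cone, `x(ξ) = exp(U λ(ξ))`, `λ(ξ)_k = −log ξ_k / c_k`)
and `Borinsky2020/TropicalSamplingEstimator` (Theorem 5 / Proposition 20: the i.i.d. mean has variance
`var[f]/N` PROVIDED `f` is square integrable).  Proposition 20 covers BOUNDED weights ("the integrand is
bounded and therefore also square integrable").  This file types the one place where the source treats an
UNBOUNDED weight:

Source: M. Borinsky, *Tropical Monte Carlo quadrature for Feynman integrals*, arXiv:2008.12310v2 = Ann.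
Inst. Henri Poincaré D 10 (2023) 635–685 [cite: Borinsky2020, §7.3 (e-print `tropical.tex` l.1254–1260;
journal §7.3)], VERBATIM: "Often not only the integral in eq. (parametric) is of interest, but also the
Taylor expansions of the parameters D and ν_e around specific points. … Effectively, such an expansion
results in integrals of the form Ĩ_G = ∫ (Π_e x_e^{ν_e}/Ψ_G^{D/2}) (Ψ_G/Φ_G)^{ω(G)} (Π_e log^{k_e}(x_e))
log^s(Ψ_G) log^t(Ψ_G/Φ_G) Ω, for some set of integers s,t ∈ ℕ and k_1,…,k_E ∈ ℕ. The estimation of this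
generalization is also possible using Algorithm 3 or Algorithm 4. Using Ĩ_G = I^tr_G ∫ (1/(Ψ_G/Ψ_G^tr)^{D/2})
((Ψ_G/Ψ_G^tr)/(Φ_G/Φ_G^tr))^{ω(G)} × (Π_e log^{k_e}(x_e)) log^s(Ψ_G) log^t(Ψ_G/Φ_G) μ^tr, gives the desired
estimate. **A caveat is that the integrand is not bounded anymore, as the logarithms will exhibit
singularities at the boundary of the integration domain. This is not a severe problem, as these
singularities are square integrable and Theorem 5 may still be applied.**"

and M. Borinsky, H. J. Munch, F. Tellander, *Tropical Feynman integration in the Minkowski regime*,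
Comput. Phys. Commun. 292 (2023) 108874 = arXiv:2302.08955v2 [cite: BorinskyMunchTellander2023, §2.4
eq. (deform_eps) (`main.tex` l.558–560; art. §2.4)], VERBATIM: "If the k=0 integral is finite, all higher
orders in ε are also finite as the log^k factors cannot spoil the integrability."

WHAT IS TYPED (the mechanism behind both sentences, in the affine sector chart of Lemma 17 / Algorithms 3–4,
where `μ^tr` restricted to one cone IS the uniform law `dξ` on the unit cube — `ConeIntegral`'s
`integral_cone_mul_exp_neg_eq_unitCube`):
* ONE VARIABLE: `|log ξ|^m ≤ t^{−m} ξ^{−tm}` on `(0,1]` (`abs_log_pow_le`, from Mathlib's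
  `Real.abs_log_mul_self_rpow_lt`), hence **`|log ξ|^m` and `(1+|log ξ|)^m` are integrable on `(0,1)` for
  every `m`** (`integrableOn_abs_log_pow_Ioo`, `integrableOn_one_add_abs_log_pow_Ioo`) — "these singularities
  are square integrable" in one sector coordinate;
* THE CUBE: products of such factors are integrable on `(0,1)^d` (Fubini, `integrableOn_unitCube_prod`;
  `integrableOn_unitCube_prod_abs_log_pow`), the uniform law on the cube is a probability law
  (`isProbabilityMeasure_volume_restrict_unitCube`), and **every weight under a poly-logarithmic envelope
  `|W(ξ)| ≤ C Π_k (1+|log ξ_k|)^M` or `|W(ξ)| ≤ C (1 + Σ_k |log ξ_k|)^M` is square integrable**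
  (`memLp_two_of_abs_le_prod_one_add_abs_log_pow`, `memLp_two_of_abs_le_one_add_sum_abs_log_pow`);
* THE PRINTED INSERTIONS: in Lemma 17's chart the logarithm of a sector coordinate is LINEAR in the
  `log ξ_k`, `log x_j(ξ) = (U λ(ξ))_j = Σ_k U_{jk}(−log ξ_k / c_k)`, so `|log x_j(ξ)| ≤ A Σ_k |log ξ_k|`
  (`abs_mulVec_logMap_le`); a product `B(ξ) · Π_j F_j(ξ)^{n_j}` of a BOUNDED factor (Corollary 9: the ratios
  `p/p^tr`) with powers of factors under an affine-logarithmic envelope `|F_j| ≤ b_j + A_j Σ_k |log ξ_k|`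
  (the `log x_e`; `log Ψ^tr`, linear in `log x`; `log Ψ_G = log Ψ^tr_G + log(Ψ_G/Ψ^tr_G)` and
  `log(Ψ_G/Φ_G)`, linear plus bounded by Theorem 8) is square integrable on the cube
  (`memLp_two_mul_prod_pow_of_abs_le_affine`), in particular §7.3's weight
  `R(ξ) Π_j (log x_j(ξ))^{k_j} L₁(ξ)^s L₂(ξ)^t` (`memLp_two_logInsertionWeight`);
* "THEOREM 5 MAY STILL BE APPLIED": for i.i.d. draws `ξ^{(ℓ)}` uniform on the cube the estimator
  `(I^tr/N) Σ_ℓ W(ξ^{(ℓ)})` of `TropicalSamplingEstimator` has variance `(I^tr)² var[W]/N`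
  (`variance_tropicalEstimate_of_logEnvelope`) — Proposition 20's conclusion WITHOUT boundedness.
NOT typed: the identification of a particular graph's `log Ψ_G ∘ x` with an affine-log-enveloped `F`
(it is `⟨y, w⟩ +` a Theorem-8-bounded term, sector by sector — the hypotheses `hF` name exactly this), the
mixture over cones of Algorithm 3 (a finite mixture of cube laws: square integrability holds iff it holds
in each cone), the ε-bookkeeping of BMT23 eq. (deform_eps) and anything about the deformed `X = ι_λ(x)`,
sums of graphs, subtractions or words.  (Filed by the pub-qed TROPICAL-track literature seat trop-lit
g32, SOURCES A45; VALUE-FREE; independent recomputation; statistical Monte-Carlo evidence elsewhere on that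
track is evidence with stated σ, not a kernel certificate; no new-physics claim.)
-/

noncomputable section

open MeasureTheory ProbabilityTheory Set Real Finset Matrix

namespace Literature.MathematicalPhysics.QuantumFieldTheory.Borinsky2020

variable {d : ℕ}

/-! ## One sector coordinate: `|log ξ|^m` is integrable on `(0,1)` -/

/-- `|log ξ|^m ≤ t^{−m} · ξ^{−tm}` for `0 < ξ ≤ 1`, `t > 0` — the logarithmic singularity at the boundary
`ξ → 0` is dominated by an arbitrarily small power (Mathlib: `|log ξ · ξ^t| < 1/t`).
[cite: Borinsky2020, §7.3 (tropical.tex l.1260) "the logarithms will exhibit singularities at the boundary"] -/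
theorem abs_log_pow_le {ξ t : ℝ} (h0 : 0 < ξ) (h1 : ξ ≤ 1) (ht : 0 < t) (m : ℕ) :
    |Real.log ξ| ^ m ≤ (1 / t) ^ m * ξ ^ (-t * m) := by
  have h := Real.abs_log_mul_self_rpow_lt ξ t h0 h1 ht
  have hξt : 0 < ξ ^ t := Real.rpow_pos_of_pos h0 t
  have hlog : |Real.log ξ| ≤ (1 / t) * ξ ^ (-t) := by
    rw [abs_mul, abs_of_pos hξt] at h
    rw [Real.rpow_neg h0.le, ← div_eq_mul_inv, le_div_iff₀ hξt]
    exact h.le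
  calc |Real.log ξ| ^ m ≤ ((1 / t) * ξ ^ (-t)) ^ m := pow_le_pow_left₀ (abs_nonneg _) hlog m
    _ = (1 / t) ^ m * ξ ^ (-t * m) := by
        rw [mul_pow, ← Real.rpow_natCast (ξ ^ (-t)) m, ← Real.rpow_mul h0.le]

/-- **"these singularities are square integrable"**, one coordinate: `|log ξ|^m` is integrable on `(0,1)`
for every `m : ℕ` (so `|log ξ|^k ∈ L^p(0,1)` for every `k` and every finite `p`).  Dominated by
`(2m)^m ξ^{−1/2}`. [cite: Borinsky2020, §7.3 (tropical.tex l.1254–1260)]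
[cite: BorinskyMunchTellander2023, §2.4 (main.tex l.560) "the log^k factors cannot spoil the integrability"] -/
theorem integrableOn_abs_log_pow_Ioo (m : ℕ) :
    IntegrableOn (fun ξ : ℝ => |Real.log ξ| ^ m) (Ioo 0 1) := by
  rcases Nat.eq_zero_or_pos m with rfl | hm
  · simp only [pow_zero]
    exact integrableOn_const (by simp [Real.volume_Ioo])
  · set t : ℝ := 1 / (2 * m) with ht
    have hmpos : (0 : ℝ) < m := Nat.cast_pos.mpr hm
    have htpos : 0 < t := by rw [ht]; positivity
    have hexp : -t * m = -(1 / 2 : ℝ) := by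
      rw [ht]; field_simp
    have hdom : IntegrableOn (fun ξ : ℝ => (1 / t) ^ m * ξ ^ (-(1 / 2 : ℝ))) (Ioo 0 1) := by
      refine Integrable.const_mul ?_ _
      have h := intervalIntegral.intervalIntegrable_rpow' (a := 0) (b := 1) (r := -(1 / 2 : ℝ))
        (by norm_num)
      exact (intervalIntegrable_iff_integrableOn_Ioo_of_le zero_le_one).mp h
    refine hdom.mono' ?_ ?_
    · exact ((Real.measurable_log.abs).pow_const m).aestronglyMeasurable
    · refine (ae_restrict_iff' measurableSet_Ioo).mpr (ae_of_all _ fun ξ hξ => ?_)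
      rw [Real.norm_eq_abs, abs_of_nonneg (pow_nonneg (abs_nonneg _) _)]
      have hb := abs_log_pow_le hξ.1 hξ.2.le htpos m
      rwa [hexp] at hb

/-- The envelope factor `(1 + |log ξ|)^n` is integrable on `(0,1)` for every `n`
(`(1+a)^n ≤ 2^{n−1}(1 + a^n)`). [cite: Borinsky2020, §7.3 (tropical.tex l.1254–1260)] -/
theorem integrableOn_one_add_abs_log_pow_Ioo (n : ℕ) :
    IntegrableOn (fun ξ : ℝ => (1 + |Real.log ξ|) ^ n) (Ioo 0 1) := by
  have hdom : IntegrableOn (fun ξ : ℝ => (2 : ℝ) ^ (n - 1) * (1 + |Real.log ξ| ^ n)) (Ioo 0 1) := by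
    refine Integrable.const_mul ?_ _
    exact (integrableOn_const (by simp [Real.volume_Ioo])).add (integrableOn_abs_log_pow_Ioo n)
  refine hdom.mono' ?_ ?_
  · exact ((measurable_const.add Real.measurable_log.abs).pow_const n).aestronglyMeasurable
  · refine ae_of_all _ fun ξ => ?_
    rw [Real.norm_eq_abs, abs_of_nonneg (by positivity)]
    have h := add_pow_le zero_le_one (abs_nonneg (Real.log ξ)) n
    simpa only [one_pow] using h

/-! ## The unit cube `(0,1)^d`: products, the uniform probability law, poly-logarithmic envelopes -/

/-- Lebesgue measure restricted to the cube is the product of the restricted one-dimensional measures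
(`dξ = Π_k dξ_k`). Plumbing. [cite: Borinsky2020, Lemma 17 (tropical.tex l.745–748) "∫_{[0,1]^{n−1}} … Π dξ_k"] -/
theorem volume_restrict_unitCube :
    (volume : Measure (Fin d → ℝ)).restrict (unitCube d)
      = Measure.pi fun _ : Fin d => (volume : Measure ℝ).restrict (Ioo 0 1) := by
  rw [unitCube, volume_pi, Measure.restrict_pi_pi]

/-- **The uniform law on the cube is a probability law** (`vol (0,1)^d = 1`): the per-cone sampling law of
Algorithms 3 / 4 ("uniformly distributed random number ξ ∈ [0,1]").
[cite: Borinsky2020, Algorithm 3 (tropical.tex l.925–934); Lemma 17 (l.745–748)] -/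
theorem isProbabilityMeasure_volume_restrict_unitCube :
    IsProbabilityMeasure ((volume : Measure (Fin d → ℝ)).restrict (unitCube d)) := by
  constructor
  rw [Measure.restrict_apply_univ, unitCube, volume_pi_pi]
  simp [Real.volume_Ioo]

/-- Fubini for integrability on the cube: a product `Π_k f_k(ξ_k)` of factors integrable on `(0,1)` is
integrable on `(0,1)^d`. [cite: Borinsky2020, Lemma 17 (tropical.tex l.745–748)] -/
theorem integrableOn_unitCube_prod (f : Fin d → ℝ → ℝ) (hf : ∀ k, IntegrableOn (f k) (Ioo 0 1)) :
    IntegrableOn (fun ξ : Fin d → ℝ => ∏ k, f k (ξ k)) (unitCube d) := by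
  rw [IntegrableOn, volume_restrict_unitCube]
  exact Integrable.fintype_prod hf

/-- **Products of powers of `|log ξ_k|` are integrable on the cube** — every monomial in the logarithms of
the sector coordinates is in `L¹((0,1)^d)` (and, the exponents being arbitrary, in every `L^p`, `p < ∞`).
[cite: Borinsky2020, §7.3 (tropical.tex l.1254–1260)] [cite: BorinskyMunchTellander2023, §2.4 (main.tex l.560)] -/
theorem integrableOn_unitCube_prod_abs_log_pow (m : Fin d → ℕ) :
    IntegrableOn (fun ξ : Fin d → ℝ => ∏ k, |Real.log (ξ k)| ^ (m k)) (unitCube d) :=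
  integrableOn_unitCube_prod (fun k x => |Real.log x| ^ (m k)) fun k => integrableOn_abs_log_pow_Ioo (m k)

/-- The product envelope `Π_k (1 + |log ξ_k|)^M` is integrable on the cube for every `M`.
[cite: Borinsky2020, §7.3 (tropical.tex l.1254–1260)] -/
theorem integrableOn_unitCube_prod_one_add_abs_log_pow (M : ℕ) :
    IntegrableOn (fun ξ : Fin d → ℝ => ∏ k, (1 + |Real.log (ξ k)|) ^ M) (unitCube d) :=
  integrableOn_unitCube_prod (fun _ x => (1 + |Real.log x|) ^ M)
    fun _ => integrableOn_one_add_abs_log_pow_Ioo M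

/-- … and it is SQUARE integrable (its square is the envelope with exponent `2M`).
[cite: Borinsky2020, §7.3 (tropical.tex l.1260) "these singularities are square integrable"] -/
theorem memLp_two_prod_one_add_abs_log_pow (M : ℕ) :
    MemLp (fun ξ : Fin d → ℝ => ∏ k, (1 + |Real.log (ξ k)|) ^ M) 2
      ((volume : Measure (Fin d → ℝ)).restrict (unitCube d)) := by
  have hmeas : AEStronglyMeasurable (fun ξ : Fin d → ℝ => ∏ k, (1 + |Real.log (ξ k)|) ^ M)
      ((volume : Measure (Fin d → ℝ)).restrict (unitCube d)) := by
    refine (Finset.measurable_prod _ fun k _ => ?_).aestronglyMeasurable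
    exact ((measurable_const.add ((Real.measurable_log.comp (measurable_pi_apply k)).abs)).pow_const M)
  rw [memLp_two_iff_integrable_sq hmeas]
  have hsq : (fun ξ : Fin d → ℝ => (∏ k, (1 + |Real.log (ξ k)|) ^ M) ^ 2)
      = fun ξ => ∏ k, (1 + |Real.log (ξ k)|) ^ (2 * M) := by
    funext ξ
    rw [← Finset.prod_pow]
    exact Finset.prod_congr rfl fun k _ => by rw [← pow_mul, mul_comm]
  rw [hsq]
  exact integrableOn_unitCube_prod_one_add_abs_log_pow (2 * M)

/-- **Poly-logarithmic envelope ⇒ square integrable (product form)**: a weight on the cube with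
`|W(ξ)| ≤ C · Π_k (1 + |log ξ_k|)^M` a.e. is in `L²((0,1)^d, dξ)`.
[cite: Borinsky2020, §7.3 (tropical.tex l.1254–1260)] [cite: BorinskyMunchTellander2023, §2.4 (main.tex l.560)] -/
theorem memLp_two_of_abs_le_prod_one_add_abs_log_pow {W : (Fin d → ℝ) → ℝ}
    (hW : AEStronglyMeasurable W ((volume : Measure (Fin d → ℝ)).restrict (unitCube d)))
    {C : ℝ} {M : ℕ}
    (hle : ∀ᵐ ξ ∂((volume : Measure (Fin d → ℝ)).restrict (unitCube d)),
      |W ξ| ≤ C * ∏ k, (1 + |Real.log (ξ k)|) ^ M) :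
    MemLp W 2 ((volume : Measure (Fin d → ℝ)).restrict (unitCube d)) := by
  refine (memLp_two_prod_one_add_abs_log_pow M).of_le_mul hW (c := C) ?_
  filter_upwards [hle] with ξ hξ
  have hnn : 0 ≤ ∏ k, (1 + |Real.log (ξ k)|) ^ M :=
    Finset.prod_nonneg fun k _ => pow_nonneg (by positivity) _
  rw [Real.norm_eq_abs, Real.norm_eq_abs, abs_of_nonneg hnn]
  exact hξ

/-- `1 + Σ_i a_i ≤ Π_i (1 + a_i)` for `a_i ≥ 0` (expand the product). Elementary helper. [folklore] -/
private theorem one_add_sum_le_prod_one_add {ι : Type*} (s : Finset ι) {a : ι → ℝ}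
    (ha : ∀ i ∈ s, 0 ≤ a i) : 1 + ∑ i ∈ s, a i ≤ ∏ i ∈ s, (1 + a i) := by
  classical
  induction s using Finset.induction_on with
  | empty => simp
  | insert i s hi ih =>
    rw [Finset.sum_insert hi, Finset.prod_insert hi]
    have h0 : 0 ≤ a i := ha i (Finset.mem_insert_self _ _)
    have hs : ∀ j ∈ s, 0 ≤ a j := fun j hj => ha j (Finset.mem_insert_of_mem hj)
    have hS : 0 ≤ ∑ j ∈ s, a j := Finset.sum_nonneg hs
    have h1 := mul_le_mul_of_nonneg_left (ih hs) (by linarith : 0 ≤ 1 + a i)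
    nlinarith [mul_nonneg h0 hS]

/-- **Poly-logarithmic envelope ⇒ square integrable (sum form)**: a weight on the cube with
`|W(ξ)| ≤ C · (1 + Σ_k |log ξ_k|)^M` a.e., `C ≥ 0`, is in `L²((0,1)^d, dξ)`.
[cite: Borinsky2020, §7.3 (tropical.tex l.1254–1260)] [cite: BorinskyMunchTellander2023, §2.4 (main.tex l.560)] -/
theorem memLp_two_of_abs_le_one_add_sum_abs_log_pow {W : (Fin d → ℝ) → ℝ}
    (hW : AEStronglyMeasurable W ((volume : Measure (Fin d → ℝ)).restrict (unitCube d)))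
    {C : ℝ} (hC : 0 ≤ C) {M : ℕ}
    (hle : ∀ᵐ ξ ∂((volume : Measure (Fin d → ℝ)).restrict (unitCube d)),
      |W ξ| ≤ C * (1 + ∑ k, |Real.log (ξ k)|) ^ M) :
    MemLp W 2 ((volume : Measure (Fin d → ℝ)).restrict (unitCube d)) := by
  refine memLp_two_of_abs_le_prod_one_add_abs_log_pow hW (C := C) (M := M) ?_
  filter_upwards [hle] with ξ hξ
  refine hξ.trans (mul_le_mul_of_nonneg_left ?_ hC)
  rw [Finset.prod_pow]
  exact pow_le_pow_left₀ (by positivity)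
    (one_add_sum_le_prod_one_add Finset.univ fun k _ => abs_nonneg _) M

/-! ## The printed insertions in the sector chart of Lemma 17 -/

/-- **The logarithm of a sector coordinate is linear in the `log ξ_k`**: in Lemma 17's coordinates
`x(ξ) = exp(U λ(ξ))`, `λ(ξ)_k = −log ξ_k / c_k`, one has `log x_j(ξ) = (U λ(ξ))_j` and hence
`|log x_j(ξ)| ≤ (Σ_k |U_{jk}|/c_k) · Σ_k |log ξ_k|` — the insertion `log^{k_e}(x_e)` is a polynomial in the
logarithms of the sector coordinates. [cite: Borinsky2020, Lemma 17 (tropical.tex l.742–748) "x_k = Π_i ξ_i^{−u_k^{(i)}/⟨u^{(i)},w⟩}"; §7.3 (l.1254–1260)] -/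
theorem abs_mulVec_logMap_le (U : Matrix (Fin d) (Fin d) ℝ) {c : Fin d → ℝ} (hc : ∀ k, 0 < c k)
    (ξ : Fin d → ℝ) (j : Fin d) :
    |(U *ᵥ logMap c ξ) j| ≤ (∑ k, |U j k| * (c k)⁻¹) * ∑ k, |Real.log (ξ k)| := by
  have hmv : (U *ᵥ logMap c ξ) j = ∑ k, U j k * logMap c ξ k := rfl
  rw [hmv]
  calc |∑ k, U j k * logMap c ξ k| ≤ ∑ k, |U j k * logMap c ξ k| := Finset.abs_sum_le_sum_abs _ _
    _ = ∑ k, (|U j k| * (c k)⁻¹) * |Real.log (ξ k)| := by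
        refine Finset.sum_congr rfl fun k _ => ?_
        rw [logMap, abs_mul, abs_mul, abs_neg, abs_inv, abs_of_pos (hc k)]
        ring
    _ ≤ ∑ k, (|U j k| * (c k)⁻¹) * ∑ l, |Real.log (ξ l)| := by
        refine Finset.sum_le_sum fun k _ =>
          mul_le_mul_of_nonneg_left ?_ (mul_nonneg (abs_nonneg _) (inv_pos.mpr (hc k)).le)
        exact Finset.single_le_sum (f := fun l => |Real.log (ξ l)|) (fun l _ => abs_nonneg _)
          (Finset.mem_univ k)
    _ = (∑ k, |U j k| * (c k)⁻¹) * ∑ k, |Real.log (ξ k)| := by rw [Finset.sum_mul]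

/-- A factor under an affine-logarithmic envelope `|F| ≤ b + A·S` (`S = Σ_k |log ξ_k|`, `0 ≤ b, A ≤ K`) has
`|F|^n ≤ K^n (1+S)^n`. Elementary bookkeeping for the product weight below. [folklore] -/
private theorem abs_pow_le_of_abs_le_affine {F b A K S : ℝ} (hS : 0 ≤ S) (hbK : b ≤ K) (hAK : A ≤ K)
    (hF : |F| ≤ b + A * S) (n : ℕ) : |F| ^ n ≤ K ^ n * (1 + S) ^ n := by
  have h1 : |F| ≤ K * (1 + S) := by nlinarith
  rw [← mul_pow]
  exact pow_le_pow_left₀ (abs_nonneg _) h1 n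

/-- **A bounded factor times powers of affine-log-enveloped factors is square integrable on the cube.**
With `S(ξ) = Σ_k |log ξ_k|`: if `|B(ξ)| ≤ C` on the cube (the bounded part — Corollary 9: the ratios `p/p^tr`
and their fixed powers) and `|F_j(ξ)| ≤ b_j + A_j S(ξ)` on the cube for every `j` (the logarithmic
insertions: `log x_e(ξ)` by `abs_mulVec_logMap_le`; `log Ψ^tr`, linear in `log x`; `log Ψ_G` and
`log(Ψ_G/Φ_G)`, linear plus a Theorem-8-bounded term), then `W = B · Π_j F_j^{n_j} ∈ L²((0,1)^d, dξ)`.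
[cite: Borinsky2020, §7.3 (tropical.tex l.1254–1260)] [cite: BorinskyMunchTellander2023, §2.4 (main.tex l.558–560)] -/
theorem memLp_two_mul_prod_pow_of_abs_le_affine {ι : Type*} (s : Finset ι)
    {B : (Fin d → ℝ) → ℝ} {F : ι → (Fin d → ℝ) → ℝ} (n : ι → ℕ) {C : ℝ} {b A : ι → ℝ}
    (hb : ∀ j ∈ s, 0 ≤ b j) (hA : ∀ j ∈ s, 0 ≤ A j)
    (hB : ∀ ξ ∈ unitCube d, |B ξ| ≤ C)
    (hF : ∀ j ∈ s, ∀ ξ ∈ unitCube d, |F j ξ| ≤ b j + A j * ∑ k, |Real.log (ξ k)|)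
    (hW : AEStronglyMeasurable (fun ξ => B ξ * ∏ j ∈ s, F j ξ ^ n j)
      ((volume : Measure (Fin d → ℝ)).restrict (unitCube d))) :
    MemLp (fun ξ => B ξ * ∏ j ∈ s, F j ξ ^ n j) 2
      ((volume : Measure (Fin d → ℝ)).restrict (unitCube d)) := by
  -- the constant of the envelope
  set K : ℝ := ∑ j ∈ s, (b j + A j) with hK
  have hbK : ∀ j ∈ s, b j ≤ K := fun j hj =>
    (le_add_of_nonneg_right (hA j hj)).trans
      (Finset.single_le_sum (f := fun i => b i + A i) (fun i hi => add_nonneg (hb i hi) (hA i hi)) hj)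
  have hAK : ∀ j ∈ s, A j ≤ K := fun j hj =>
    (le_add_of_nonneg_left (hb j hj)).trans
      (Finset.single_le_sum (f := fun i => b i + A i) (fun i hi => add_nonneg (hb i hi) (hA i hi)) hj)
  -- `C ≥ 0`: the cube is non-empty
  have hC : 0 ≤ C := by
    have hmem : (fun _ : Fin d => (1 / 2 : ℝ)) ∈ unitCube d :=
      mem_unitCube.mpr fun _ => ⟨by norm_num, by norm_num⟩
    exact (abs_nonneg _).trans (hB _ hmem)
  refine memLp_two_of_abs_le_one_add_sum_abs_log_pow hW (C := C * K ^ (∑ j ∈ s, n j))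
    (mul_nonneg hC (pow_nonneg (Finset.sum_nonneg fun i hi => add_nonneg (hb i hi) (hA i hi)) _))
    (M := ∑ j ∈ s, n j) ?_
  refine (ae_restrict_iff' measurableSet_unitCube).mpr (ae_of_all _ fun ξ hξ => ?_)
  set S : ℝ := ∑ k, |Real.log (ξ k)| with hSdef
  have hS : 0 ≤ S := Finset.sum_nonneg fun k _ => abs_nonneg _
  have hprod : |∏ j ∈ s, F j ξ ^ n j| ≤ ∏ j ∈ s, (K ^ n j * (1 + S) ^ n j) := by
    rw [Finset.abs_prod]
    refine Finset.prod_le_prod (fun j _ => abs_nonneg _) fun j hj => ?_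
    rw [abs_pow]
    exact abs_pow_le_of_abs_le_affine hS (hbK j hj) (hAK j hj) (hF j hj ξ hξ) (n j)
  have hgather : ∏ j ∈ s, (K ^ n j * (1 + S) ^ n j) = K ^ (∑ j ∈ s, n j) * (1 + S) ^ (∑ j ∈ s, n j) := by
    rw [Finset.prod_mul_distrib, Finset.prod_pow_eq_pow_sum, Finset.prod_pow_eq_pow_sum]
  rw [abs_mul]
  calc |B ξ| * |∏ j ∈ s, F j ξ ^ n j|
      ≤ C * ∏ j ∈ s, (K ^ n j * (1 + S) ^ n j) :=
        mul_le_mul (hB ξ hξ) hprod (abs_nonneg _) hC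
    _ = C * K ^ (∑ j ∈ s, n j) * (1 + S) ^ (∑ j ∈ s, n j) := by rw [hgather, mul_assoc]

/-- **§7.3's weight is square integrable in every sector**: in Lemma 17's chart (`x(ξ) = exp(U λ(ξ))`,
`c_k = ⟨u^{(k)}, w⟩ > 0`), the pulled-back integrand
`W(ξ) = R(ξ) · Π_j (log x_j(ξ))^{k_j} · L₁(ξ)^s · L₂(ξ)^t`
— `R` the BOUNDED product of ratios `(Ψ_G/Ψ^tr_G)^{−D/2}((Ψ_G/Ψ^tr_G)/(Φ_G/Φ^tr_G))^{ω(G)}` (Corollary 9),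
`log x_j(ξ) = (U λ(ξ))_j` the edge-variable logarithms, and `L₁ = log Ψ_G ∘ x`, `L₂ = log(Ψ_G/Φ_G) ∘ x`
any factors under an affine-logarithmic envelope `|L_i(ξ)| ≤ b_i + A_i Σ_k |log ξ_k|` (which they are:
`log p^tr(x(ξ))` is linear in `log ξ` on the sector and `|log(p/p^tr)| ≤ max(|log C₁|, |log C₂|)` by
Theorem 8) — is in `L²((0,1)^d, dξ)`: "the integrand is not bounded anymore … these singularities are
square integrable". [cite: Borinsky2020, §7.3 (tropical.tex l.1254–1260); Lemma 17 (l.742–748)]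
[cite: BorinskyMunchTellander2023, §2.4 eq. (deform_eps) (main.tex l.558–560)] -/
theorem memLp_two_logInsertionWeight (U : Matrix (Fin d) (Fin d) ℝ) {c : Fin d → ℝ}
    (hc : ∀ k, 0 < c k) {R L₁ L₂ : (Fin d → ℝ) → ℝ} (k : Fin d → ℕ) (s t : ℕ)
    {C b₁ A₁ b₂ A₂ : ℝ} (hb₁ : 0 ≤ b₁) (hA₁ : 0 ≤ A₁) (hb₂ : 0 ≤ b₂) (hA₂ : 0 ≤ A₂)
    (hR : ∀ ξ ∈ unitCube d, |R ξ| ≤ C)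
    (hL₁ : ∀ ξ ∈ unitCube d, |L₁ ξ| ≤ b₁ + A₁ * ∑ k, |Real.log (ξ k)|)
    (hL₂ : ∀ ξ ∈ unitCube d, |L₂ ξ| ≤ b₂ + A₂ * ∑ k, |Real.log (ξ k)|)
    (hW : AEStronglyMeasurable
      (fun ξ => R ξ * ((∏ j, ((U *ᵥ logMap c ξ) j) ^ k j) * L₁ ξ ^ s * L₂ ξ ^ t))
      ((volume : Measure (Fin d → ℝ)).restrict (unitCube d))) :
    MemLp (fun ξ => R ξ * ((∏ j, ((U *ᵥ logMap c ξ) j) ^ k j) * L₁ ξ ^ s * L₂ ξ ^ t)) 2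
      ((volume : Measure (Fin d → ℝ)).restrict (unitCube d)) := by
  -- index the factors by `Option (Option (Fin d))`: `some (some j)` ↦ log x_j, `some none` ↦ L₁, `none` ↦ L₂
  let F : Option (Option (Fin d)) → (Fin d → ℝ) → ℝ := fun o ξ =>
    match o with
    | some (some j) => (U *ᵥ logMap c ξ) j
    | some none => L₁ ξ
    | none => L₂ ξ
  let n : Option (Option (Fin d)) → ℕ := fun o =>
    match o with
    | some (some j) => k j
    | some none => s
    | none => t
  let b : Option (Option (Fin d)) → ℝ := fun o =>
    match o with
    | some (some _) => 0
    | some none => b₁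
    | none => b₂
  let A : Option (Option (Fin d)) → ℝ := fun o =>
    match o with
    | some (some j) => ∑ l, |U j l| * (c l)⁻¹
    | some none => A₁
    | none => A₂
  have hfun : (fun ξ => R ξ * ((∏ j, ((U *ᵥ logMap c ξ) j) ^ k j) * L₁ ξ ^ s * L₂ ξ ^ t))
      = fun ξ => R ξ * ∏ o ∈ (Finset.univ : Finset (Option (Option (Fin d)))), F o ξ ^ n o := by
    funext ξ
    congr 1
    rw [Fintype.prod_option, Fintype.prod_option]
    simp only [F, n]
    ring
  rw [hfun] at hW ⊢
  refine memLp_two_mul_prod_pow_of_abs_le_affine Finset.univ n (b := b) (A := A)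
    (fun o _ => ?_) (fun o _ => ?_) hR (fun o _ ξ hξ => ?_) hW
  · rcases o with _ | _ | j
    · exact hb₂
    · exact hb₁
    · exact le_rfl
  · rcases o with _ | _ | j
    · exact hA₂
    · exact hA₁
    · exact Finset.sum_nonneg fun l _ => mul_nonneg (abs_nonneg _) (inv_pos.mpr (hc l)).le
  · rcases o with _ | _ | j
    · exact hL₂ ξ hξ
    · exact hL₁ ξ hξ
    · simp only [F, b, A, zero_add]
      exact abs_mulVec_logMap_le U hc ξ j

/-! ## «Theorem 5 may still be applied» -/

/-- **«Theorem 5 may still be applied»**: for i.i.d. draws `ξ^{(0)}, ξ^{(1)}, …` uniform on the cube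
(the per-cone law of Algorithms 3 / 4) and ANY weight `W` under a poly-logarithmic envelope
`|W(ξ)| ≤ C (1 + Σ_k |log ξ_k|)^M` — bounded or not — Algorithm 2's estimate
`I^{(N)} = (I^tr/N) Σ_{ℓ<N} W(ξ^{(ℓ)})` has the finite variance `(I^tr)² var[W] / N` of Theorem 5:
Proposition 20's conclusion `var[I^{(N)}] = C/N` WITHOUT its boundedness hypothesis.
[cite: Borinsky2020, §7.3 (tropical.tex l.1260) "Theorem 5 may still be applied"; Theorem 5 (l.349–355); Proposition 20 (l.859–867)] -/
theorem variance_tropicalEstimate_of_logEnvelope {Ω : Type*} {mΩ : MeasurableSpace Ω} {P : Measure Ω}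
    {x : ℕ → Ω → (Fin d → ℝ)} {W : (Fin d → ℝ) → ℝ} (hWm : Measurable W)
    (hlaw : HasLaw (x 0) ((volume : Measure (Fin d → ℝ)).restrict (unitCube d)) P)
    (hindep : iIndepFun x P) (hident : ∀ k, IdentDistrib (x k) (x 0) P P)
    {C : ℝ} (hC : 0 ≤ C) {M : ℕ}
    (hle : ∀ ξ ∈ unitCube d, |W ξ| ≤ C * (1 + ∑ k, |Real.log (ξ k)|) ^ M)
    {N : ℕ} (hN : N ≠ 0) (Itr : ℝ) :
    Var[tropicalEstimate Itr W x N; P]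
      = Itr ^ 2 * Var[W; (volume : Measure (Fin d → ℝ)).restrict (unitCube d)] / N :=
  variance_tropicalEstimate hWm hlaw hindep hident
    (memLp_two_of_abs_le_one_add_sum_abs_log_pow hWm.aestronglyMeasurable hC
      ((ae_restrict_iff' measurableSet_unitCube).mpr (ae_of_all _ hle))) hN Itr

end Literature.MathematicalPhysics.QuantumFieldTheory.Borinsky2020

end
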